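import Literature.AlgebraicGeometry.AbelianSchemes.PoincarePullbackStabilizer
import Literature.AlgebraicGeometry.AbelianSchemes.PoincarePullbackSliceSpread
import Literature.AlgebraicGeometry.AbelianSchemes.PoincarePullbackKernelCountGeometric
import Literature.AlgebraicGeometry.Morphisms.ConnectedComponentRationalPoint
import HarnessLib

/-!
# (K) for the dual-of-a-quotient over a base of finite type over ANY algebraically closed field: `hStab` from a hat level
# structure and the count — the characteristic-free twin of ★ `PoincarePullbackStabilizerOfLevel`

Layer `Literature/AlgebraicGeometry/AbelianSchemes`, namespace `Literature.AlgebraicGeometry.AbelianSchemes.AbelianSchemeOver`.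
THEOREMS ONLY (no definition, no named fact, no instance, no notation, no `sorry`).

Setting of ★ `PoincarePullbackStabilizer` ([MumfordAV1970] §15 Thm. 1: the dual of `B := A/K` is `Â/K′`): an abelian scheme `A/S`
over a reduced locally Noetherian base, `K ≤ A(S)` finite `n`-torsion acting freely with quotient `B = A/K`, `π := mulNDesc : B → A`
(`ψ ≫ π = [n]_A`), the dual pair `D = (Â, 𝒫)` with the unit hypothesis `hD`, `𝒩₁ := (π × 1_Â)^*𝒫` on `B ×_S Â`, a finite
subgroup `K′ ≤ Â(S)`.  The ★ file `PoincarePullbackStabilizerOfLevel` discharges the hypothesis `hStab` of ★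
`existsUnique_poincareQuotRigid_of_exists` / ★ `universal_poincareQuotRigid_of_fpqcLocal` /
★ `exists_fpqcCover_pullback_poincareQuotRigid_iso_of_isLocallyNoetherian` over a base `p : S → Spec ℂ` locally of finite type,
counting at complex points.  This file is the SAME over `p : S → Spec Ω₀` for ANY algebraically closed field `Ω₀` with
`(n : Ω₀) ≠ 0` — e.g. `S = Spec κ̄(w)`, `p = 𝟙`, in characteristic `p ∤ n` — counting at `Ω₀`-valued points:

* §1 `natCard_le_ncard_setOf_section_mem'` (private, universe-polymorphic re-run of the ★ §1 lemma) and
  `natCast_residueField_ne_zero_of_specMap` — `(n : κ(s)) ≠ 0` at every point of a scheme over a field in which `n ≠ 0`;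
* §2 **`hStab_of_level_of_count_geometric`** — `hStab` from `K′ ⊆ Stab(𝒩₁)`, a level-`n` structure `φ̂` on `Â` with
  `K′ ⊆ φ̂((ℤ/n)^{2g})`, the COUNT at `Ω₀`-points «`#{b ∈ Â_t(Ω₀) : (1_B × b)^*𝒩₁ ≅ 𝒪} · #K ≤ n^{2g}`» and `n^{2g} ≤ #K · #K′`
  (★ `hStab_of_spread_of_ncard_le` at `Ω₀`; `hK′triv` by ★ (K-dict) `nonempty_pullback_whiskerLeft_translation_iso_iff` + ★
  `nonempty_pullback_baseChangeToProd_restrict_iso_unit`; `hspread` by ★ `exists_point_slice_iso_unit_of_nonempty` with ★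
  `exists_base_closedPoint_mem_connectedComponent` — every connected component of `S` has an `Ω₀`-point, `S` being Jacobson);
* §3 **`hStab_of_level_of_natCard_eq_geometric`** — THE ONE-TOKEN FORM: the count discharged by ★
  `finite_and_ncard_mul_natCard_le_pow_geometric` ([MumfordAV1970] §15 Thm. 1 at a geometric point with `π_t` étale, ★
  `PoincarePullbackKernelCountGeometric`), leaving `(Ω₀) (p) (hA : A.IsOfRelDim g) (hn0 : (n : Ω₀) ≠ 0) (hD) (φ̂) (hK'φ) (hK'stab)
  (hcard : #K · #K′ = n^{2g})` — the ★ binders with `ℂ ↦ Ω₀`.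

Cell `hodgecm-mathlib` (D-0151), crux hLiu418, line L3 `stub_FROB`/`stub_ROOF0` (RULING «DUAL-B̄» #3, organ H5: the `hStab` package at
`S = Spec κ̄(w)`).  Count-neutral; HC_CM is proved only modulo the 7 printed citations until rung 0 closes; nothing here is about HC.

## References
* [MumfordAV1970] D. Mumford, *Abelian Varieties* (1970), §15 Thm. 1 (p. 143); §6 Application 3 (p. 64).
* [MilneAV2008] J. S. Milne, *Abelian Varieties* (v2.00, 2008), I §8 (pp. 36–37).
* [MumfordFogartyKirwan1994] D. Mumford, J. Fogarty, F. Kirwan, *Geometric Invariant Theory*, 3rd ed. (1994), Ch. 7 §2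
  Definition 7.1 (p. 129).
* [StacksProject] Tag 04MF (connected components of locally Noetherian schemes are open), Tag 01S4.
* [GortzWedhorn2020] U. Görtz, T. Wedhorn, *Algebraic Geometry I* (2nd ed., 2020), Cor. 3.36 (p. 83) (closed points of schemes of
  finite type over a field).
-/

set_option autoImplicit false

noncomputable section

-- `poincarePullbackBundle.L = (π ▷ Â)^*𝒫`, `(A.baseChange f).X = (Over.pullback f).obj A.X` hold by `rfl` only
-- (`Scheme.Modules` / `SheafOfModules` are not reducible, as in Mathlib's `AlgebraicGeometry/Modules/Sheaf.lean`).
set_option backward.isDefEq.respectTransparency false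

universe u

open CategoryTheory CategoryTheory.Limits AlgebraicGeometry MonoidalCategory CartesianMonoidalCategory
open scoped MonObj

namespace Literature.AlgebraicGeometry.AbelianSchemes

namespace AbelianSchemeOver

open Literature.AlgebraicGeometry.RelativeSpec Literature.AlgebraicGeometry.Motives Literature.AlgebraicGeometry.Morphisms

/-! ## §1 Counting the constant sections in `K′`; `n ≠ 0` in the residue fields -/

variable {S : Scheme.{u}} (A : AbelianSchemeOver S)

/-- If `K′ ≤ Â(S)` consists of constant sections `φ̂(c)` of a level-`n` structure `φ̂` (`n ≠ 0`), then
`#K′ ≤ #{c : (ℤ/n)^{2g} | φ̂(c) ∈ K′}` (`c ↦ φ̂(c)` maps that finite index set ONTO `K′`) — universe-polymorphic private re-run of ★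
`natCard_le_ncard_setOf_section_mem`. [cite: MumfordFogartyKirwan1994, Ch. 7 §2 Definition 7.1 (p. 129)] -/
private theorem natCard_le_ncard_setOf_section_mem' {g n : ℕ} [NeZero n] (φ : LevelStructure g n A)
    (K' : Subgroup A.Sections) (hK'φ : (K' : Set A.Sections) ⊆ Set.range φ.section_) :
    Nat.card K' ≤ {c : Fin g ⊕ Fin g → ZMod n | φ.section_ c ∈ K'}.ncard := by
  classical
  rw [← Nat.card_coe_set_eq]
  refine Nat.card_le_card_of_surjective
    (fun c : {c : Fin g ⊕ Fin g → ZMod n | φ.section_ c ∈ K'} => (⟨φ.section_ c.1, c.2⟩ : K')) ?_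
  rintro ⟨k, hk⟩
  obtain ⟨c, hc⟩ := hK'φ hk
  exact ⟨⟨c, by simpa only [Set.mem_setOf_eq, hc] using hk⟩, Subtype.ext hc⟩

/-- **`n ≠ 0` in `Ω₀` ⇒ `n ≠ 0` in every residue field of a scheme over `Spec Ω₀`** (the structure map `Ω₀ → κ(s)`, read off
`Spec κ(s) → S → Spec Ω₀` by `Spec.preimage`, is a ring map out of a field). [cite: GortzWedhorn2020, Cor. 3.36 (p. 83)] -/
theorem natCast_residueField_ne_zero_of_specMap {Ω₀ : Type u} [Field Ω₀] (p : S ⟶ Spec (.of Ω₀)) (s : S) {n : ℕ}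
    (hn0 : (n : Ω₀) ≠ 0) : (n : S.residueField s) ≠ 0 := by
  let c : Ω₀ →+* S.residueField s := (Spec.preimage (S.fromSpecResidueField s ≫ p)).hom
  rw [← map_natCast c n]
  exact (map_ne_zero c).mpr hn0

/-! ## §2 `hStab` over a base of finite type over an algebraically closed field, from a hat level structure and the count -/

variable {Y : Scheme.{u}} (u : S ⟶ Y) (K : Subgroup A.Sections) [IsCommMonObj A.X] {n : ℕ}
  (hK : ∀ σ : K, (σ : A.Sections) ^ n = 1)
  [Finite K] [Y.IsSeparated] [IsSeparated (A.X.hom ≫ u)] [S.IsSeparated]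
  (hcov : ∀ x : A.left, ∃ O : (A.translationActionOver u K).StableAffineOpens, x ∈ O.1)
  [LocallyOfFiniteType (A.X.hom ≫ u)] [IsLocallyNoetherian Y]
  (hG : ∃ _ : GrpObj (A.quotientOver u K), IsMonHom (A.quotientMk u K hcov))
  (hsm : Smooth (A.quotientOver u K).hom) (hgc : GeometricallyConnected (A.quotientOver u K).hom)
  (D : A.DualPair) [IsAffine Y]
  (hfree : ∀ (Ω : Type u) [Field Ω] [IsAlgClosed Ω] (x : Spec (.of Ω) ⟶ A.left) (σ : K), σ ≠ 1 →
    x ≫ (A.translation (σ : A.Sections)).left ≠ x)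
  (K' : Subgroup D.hat.Sections) [Finite K'] [IsSeparated (D.hat.X.hom ≫ u)]
  (hcov' : ∀ x : D.hat.left, ∃ O : (D.hat.translationActionOver u K').StableAffineOpens, x ∈ O.1)

/-- **`hStab` over a base locally of finite type over an ALGEBRAICALLY CLOSED FIELD `Ω₀` of any characteristic, from
`K′ ⊆ Stab(𝒩₁)`, a hat level structure covering `K′`, and the count at `Ω₀`-points.**  For `S` reduced, locally Noetherian and
locally of finite type over `Ω₀` (`p : S → Spec Ω₀`), `(n : Ω₀) ≠ 0`, the unit hypothesis `hD`, a level-`n` structure `φ̂` on `Â` with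
`K′ ⊆ φ̂((ℤ/n)^{2g})`, `K′ ⊆ Stab(𝒩₁)`, `#{b ∈ Â_t(Ω₀) : (1_B × b)^*𝒩₁ ≅ 𝒪} · #K ≤ n^{2g}` at every `Ω₀`-point `t` of `S`, and
`n^{2g} ≤ #K · #K′`: for all `f : T → S` and `a a′ : T → Â` over `f`, `(1_B × a)^*𝒩₁ ≅ (1_B × a′)^*𝒩₁ ⟹ a ≫ ψ̂ = a′ ≫ ψ̂`,
`ψ̂ : Â → Â/K′`.  Proof = ★ `hStab_of_level_of_count` with `ℂ ↦ Ω₀`: ★ `hStab_of_spread_of_ncard_le` at `Ω₀`; `hK′triv` by ★ (K-dict)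
`nonempty_pullback_whiskerLeft_translation_iso_iff` + ★ `nonempty_pullback_baseChangeToProd_restrict_iso_unit`; `hspread` by ★
`exists_point_slice_iso_unit_of_nonempty` with ★ `exists_base_closedPoint_mem_connectedComponent`; `hn` from `Ω₀ → κ(s)`; the set count
from the two numeric counts and §1 after cancelling `#K ≥ 1`. [cite: MumfordAV1970, §15 Thm. 1 (p. 143)] [cite: MilneAV2008, I §8 (pp. 36–37)] -/
theorem hStab_of_level_of_count_geometric [IsReduced S] [IsLocallyNoetherian S] (Ω₀ : Type u) [Field Ω₀] [IsAlgClosed Ω₀]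
    (p : S ⟶ Spec (.of Ω₀)) [LocallyOfFiniteType p] (hn0 : (n : Ω₀) ≠ 0)
    (hD : Nonempty ((Scheme.Modules.pullback (DualPair.unitHatSlice D)).obj D.P ≅ SheafOfModules.unit _))
    {g : ℕ} (φ : LevelStructure g n D.hat) (hK'φ : (K' : Set D.hat.Sections) ⊆ Set.range φ.section_)
    (hK'stab : K' ≤ A.poincareStabilizerSubgroup u K hK hcov hG hsm hgc D hfree)
    (hcount : ∀ t : Spec (.of Ω₀) ⟶ S,
      {b : D.hat.FibrePoints t | Nonempty ((Scheme.Modules.pullback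
          ((A.quotientBy u K hcov hG hsm hgc).baseChangeToProd D.hat t b.left (Over.w b))).obj
          (A.poincarePullbackBundle u K hK hcov hG hsm hgc D hfree).L ≅ SheafOfModules.unit _)}.Finite ∧
      {b : D.hat.FibrePoints t | Nonempty ((Scheme.Modules.pullback
          ((A.quotientBy u K hcov hG hsm hgc).baseChangeToProd D.hat t b.left (Over.w b))).obj
          (A.poincarePullbackBundle u K hK hcov hG hsm hgc D hfree).L ≅ SheafOfModules.unit _)}.ncard * Nat.card K ≤
        n ^ (2 * g))
    (hcard : n ^ (2 * g) ≤ Nat.card K * Nat.card K')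
    {T : Scheme.{u}} (f : T ⟶ S) (a a' : T ⟶ D.hat.X.left) (ha : a ≫ D.hat.X.hom = f)
    (ha' : a' ≫ D.hat.X.hom = f)
    (h : Nonempty ((Scheme.Modules.pullback ((A.quotientBy u K hcov hG hsm hgc).baseChangeToProd D.hat f a ha)).obj
        (A.poincarePullbackBundle u K hK hcov hG hsm hgc D hfree).L ≅
      (Scheme.Modules.pullback ((A.quotientBy u K hcov hG hsm hgc).baseChangeToProd D.hat f a' ha')).obj
        (A.poincarePullbackBundle u K hK hcov hG hsm hgc D hfree).L)) :
    a ≫ (D.hat.quotientMk u K' hcov').left = a' ≫ (D.hat.quotientMk u K' hcov').left := by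
  classical
  haveI : NeZero n := ⟨fun h0 => hn0 (by rw [h0, Nat.cast_zero])⟩
  -- `n` is invertible on the `Ω₀`-scheme `S`
  have hn : ∀ s : S, (n : S.residueField s) ≠ 0 := fun s => natCast_residueField_ne_zero_of_specMap p s hn0
  -- `#K ≥ 1`
  have hKpos : 0 < Nat.card K := Nat.card_pos
  refine A.hStab_of_spread_of_ncard_le u K hK hcov hG hsm hgc D hfree K' hcov' φ hn Ω₀ hD ?_ ?_ ?_ f a a' ha ha' h
  · -- `hK′triv`: every `k ∈ K′ ⊆ Stab(𝒩₁)` has trivial class at every `Ω₀`-point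
    intro k hk t
    exact DualPair.nonempty_pullback_baseChangeToProd_restrict_iso_unit (X := A.quotientBy u K hcov hG hsm hgc) D
      (A.mulNDesc u K hK hcov) k
      ((DualPair.nonempty_pullback_whiskerLeft_translation_iso_iff D (A.mulNDesc u K hK hcov) k hD).1 (hK'stab hk)) t
  · -- `hcard`: the set count at `Ω₀`-points
    intro t
    refine ⟨(hcount t).1, ?_⟩
    have h1 := (hcount t).2
    have h2 : Nat.card K * Nat.card K' ≤
        Nat.card K * {c : Fin g ⊕ Fin g → ZMod n | φ.section_ c ∈ K'}.ncard :=
      Nat.mul_le_mul_left _ (D.hat.natCard_le_ncard_setOf_section_mem' φ K' hK'φ)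
    have h3 := (h1.trans hcard).trans h2
    rw [Nat.mul_comm] at h3
    exact Nat.le_of_mul_le_mul_left h3 hKpos
  · -- `hspread`: ★ (K4-spread) with every component meeting an `Ω₀`-point (`S` is Jacobson)
    intro c U w _ hU
    exact DualPair.exists_point_slice_iso_unit_of_nonempty A u K hK hcov hG hsm hgc D hfree Ω₀ hD hn φ
      (exists_base_closedPoint_mem_connectedComponent p) c w hU

/-! ## §3 The one-token form: the count at geometric points discharged -/

/-- **THE D6 `hStab` BINDER OVER A BASE OF FINITE TYPE OVER ANY ALGEBRAICALLY CLOSED FIELD — one token for the package composer.**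
For `S` reduced, locally Noetherian and locally of finite type over `Ω₀` (algebraically closed, `(n : Ω₀) ≠ 0`), `A/S` of relative
dimension `g`, the unit hypothesis `hD`, a level-`n` structure `φ̂` on `Â` with `K′ ⊆ φ̂((ℤ/n)^{2g})`, `K′ ⊆ Stab(𝒩₁)` and
`#K · #K′ = n^{2g}`: for all `f : T → S` and `a a′ : T → Â` over `f`, `(1_B × a)^*𝒩₁ ≅ (1_B × a′)^*𝒩₁ ⟹ a ≫ ψ̂ = a′ ≫ ψ̂` —
`hStab_of_level_of_count_geometric` with its `hcount` binder DISCHARGED by ★ `finite_and_ncard_mul_natCard_le_pow_geometric`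
([MumfordAV1970] §15 Thm. 1 at a geometric point, `π_t` étale since `(n : Ω₀) ≠ 0`: `#T_t · #K ≤ n^{2g}`).  At `S = Spec κ̄(w)`,
`p = 𝟙`, this is the `hStab` hypothesis of ★ `existsUnique_poincareQuotRigid_of_exists` / ★ `universal_poincareQuotRigid_of_fpqcLocal`
verbatim, in characteristic `p ∤ n`. [cite: MumfordAV1970, §15 Thm. 1 (p. 143)] [cite: MilneAV2008, I §8 (pp. 36–37)] -/
theorem hStab_of_level_of_natCard_eq_geometric [IsReduced S] [IsLocallyNoetherian S] (Ω₀ : Type u) [Field Ω₀] [IsAlgClosed Ω₀]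
    (p : S ⟶ Spec (.of Ω₀)) [LocallyOfFiniteType p] {g : ℕ} (hA : A.IsOfRelDim g) (hn0 : (n : Ω₀) ≠ 0)
    (hD : Nonempty ((Scheme.Modules.pullback (DualPair.unitHatSlice D)).obj D.P ≅ SheafOfModules.unit _))
    (φ : LevelStructure g n D.hat) (hK'φ : (K' : Set D.hat.Sections) ⊆ Set.range φ.section_)
    (hK'stab : K' ≤ A.poincareStabilizerSubgroup u K hK hcov hG hsm hgc D hfree)
    (hcard : Nat.card K * Nat.card K' = n ^ (2 * g))
    {T : Scheme.{u}} (f : T ⟶ S) (a a' : T ⟶ D.hat.X.left) (ha : a ≫ D.hat.X.hom = f)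
    (ha' : a' ≫ D.hat.X.hom = f)
    (h : Nonempty ((Scheme.Modules.pullback ((A.quotientBy u K hcov hG hsm hgc).baseChangeToProd D.hat f a ha)).obj
        (A.poincarePullbackBundle u K hK hcov hG hsm hgc D hfree).L ≅
      (Scheme.Modules.pullback ((A.quotientBy u K hcov hG hsm hgc).baseChangeToProd D.hat f a' ha')).obj
        (A.poincarePullbackBundle u K hK hcov hG hsm hgc D hfree).L)) :
    a ≫ (D.hat.quotientMk u K' hcov').left = a' ≫ (D.hat.quotientMk u K' hcov').left :=
  A.hStab_of_level_of_count_geometric u K hK hcov hG hsm hgc D hfree K' hcov' Ω₀ p hn0 hD φ hK'φ hK'stab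
    (fun t => A.finite_and_ncard_mul_natCard_le_pow_geometric u K hK hcov hG hsm hgc hfree D hA t hn0) hcard.ge f a a' ha ha' h

end AbelianSchemeOver

end Literature.AlgebraicGeometry.AbelianSchemes

end
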